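import Literature.NumberTheory.EllipticCurves.KolyvaginShaStructureCertificate
import Summits.BirchSwinnertonDyer.Rank1Residual.X11b.Three.KolyvaginLine
import HarnessLib

/-!
# X11b at `p = 3` (team N8/O2), K5 · KOLY-LINE, part 2: STEP L from the CITED general-level
# Kolyvagin–McCallum certificate fact (the labelled hypothesis `h56` of `KolyvaginLine.lean`
# replaced by the Literature fact `McCallum1991_pow_dvd_card_sha_primary_of_certificate`)

HONEST FRAMING (cell `b2b-bsdres`, run/shared/lean/b2b/bsd-rank1-residual/, verbatim in every
file): the goal of the cell is to DELETE the COMBINATION-SHAPED residual classes of the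
Birch–Swinnerton-Dyer formula for ALL analytic-rank `≤ 1` elliptic curves over `ℚ` — "full BSD
formula for every rank `≤ 1` curve in class `C`" assembled STRICTLY from published theorems — so
that the rank-`≤ 1` remainder becomes exactly the CONSTRUCTION-SHAPED classes, which are TYPED
(missing-input `Prop`s), NOT attempted. This is not "finishing BSD". Team N8/O2 = `x11b3`, seat
`b2b-bsdres-x11b3-p1`, LEAD DEAL #3 row K5 (the ONE allowed cited fact, lit1 L34 dedup: new
content). THEOREMS ONLY; CONDITIONAL on the named fact (taken as the hypothesis `hMc`, an unproved
published result — McCallum 1991 Cor. 5.6, size XL); nothing booked; O2 unchanged.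

## What

`Koly.indexLowerBoundAt_of_certificate_of_mccallum`: for `W/ℚ` globally minimal non-CM, `K`
imaginary quadratic Heegner for `N_E` with `d_K ∉ {−3,−4}`, `p` odd with `ρ̄_{E,p^n}` onto for all
`n` (the fact's binder; printed: mod `p`), `(Dt, β, ι)`, the conductor-`1` datum `d₁` and the point
`P ∈ E(K)` under `P_1 = y_K`, of infinite order, `E(K)` of rank one without `p`-torsion, `Ш(E/K)`
finite, `p^{M₀} ∥ P` in `E(K)`, and ONE certificate (`n` square-free, all `ℓ ∣ n` Kolyvagin primes
with `M(ℓ) ≥ M + 1`, a datum `d` of conductor `n` with `P_n ∉ p^{M+1}E(K[n])`) of depth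
`M ≤ t := ord_p ∏ c_ℓ(E/ℚ)`: the fact gives `2(M₀ − M) ≤ ord_p #Ш(E/K)[p^∞]`, and the bridges
B1/B2 of `KolyvaginLine.lean` turn this into `X11b.IndexLowerBoundAt W p K P`
(`2·ord_p[E(K):ℤP] ≤ ord_p #Ш(E/K) + 2t`). At `p = 3` this is the team's STEP L at `3 ∥ N` on
LINE K, per pair, from a certificate (K0⋆: `M_∞ ≤ t`).

References: McCallum 1991 (LMS LN 153) §5 Cor. 5.6, Lemma 5.1; team files `cells/x11b3/LINE-K.md`
blocks 1–3, `cells/x11b3/LIT-TABLE.md` L34.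
-/

noncomputable section

open scoped Classical

namespace Summit.BirchSwinnertonDyer.Rank1Residual.X11b.Three.Koly

open WeierstrassCurve Literature.NumberTheory.EllipticCurves
  Literature.NumberTheory.EllipticCurves.ModularForms

/-- **STEP L from ONE Kolyvagin certificate, via the cited Kolyvagin–McCallum fact.** See the module
docstring. CONDITIONAL on `McCallum1991_pow_dvd_card_sha_primary_of_certificate` (hypothesis
`hMc`). [cite: McCallumLMS1991, §5 Cor. 5.6 (p. 310) and Lemma 5.1 (p. 303)] -/
theorem indexLowerBoundAt_of_certificate_of_mccallum
    (hMc : McCallum1991_pow_dvd_card_sha_primary_of_certificate)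
    (W : WeierstrassCurve ℚ) [W.IsElliptic] [W.IsGloballyMinimal] [NeZero (W.conductorNorm ℤ)]
    (hCM : ¬ W.HasCM) (K : Type) [Field K] [NumberField K] (hK : IsImaginaryQuadratic K)
    (h3 : NumberField.discr K ≠ -3) (h4 : NumberField.discr K ≠ -4)
    (hH : SatisfiesHeegnerHypothesis (W.conductorNorm ℤ) K)
    (p : ℕ) [Fact p.Prime] (hp : p ≠ 2) (hsurj : ∀ n : ℕ, W.HasSurjectiveModNGaloisRep (p ^ n : ℕ))
    (Dt : ModularParametrizationData W (W.conductorNorm ℤ)) (β : ℤ) (ι : K →+* ℂ)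
    (d₁ : KolyvaginHeegnerData Dt β ι 1) (P : (W.baseChange K).toAffine.Point)
    (hP : d₁.toGeomPoints d₁.derivedPoint = toGeomPoints (W.baseChange K) P)
    (hPinf : ¬ IsOfFinAddOrder P)
    (hrank : (W.baseChange K).mordellWeilRank = 1)
    (hiv : ∀ x : (W.baseChange K).toAffine.Point, p • x = 0 → x = 0)
    [Finite (W.baseChange K).sha] {M₀ : ℕ}
    (hdiv : ∃ Q : (W.baseChange K).toAffine.Point, ((p ^ M₀ : ℕ) : ℤ) • Q = P)
    (hndiv : ¬ ∃ Q : (W.baseChange K).toAffine.Point, ((p ^ (M₀ + 1) : ℕ) : ℤ) • Q = P)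
    {n M : ℕ} (d : KolyvaginHeegnerData Dt β ι n) (hn : Squarefree n)
    (hℓ : ∀ ℓ ∈ n.primeFactors, Zhang2014.IsKolyvaginPrime (W.conductorNorm ℤ) W K p ℓ ∧
      M + 1 ≤ Zhang2014.kolyvaginIndex W p ℓ)
    (hcert : ¬ PDiv d p (M + 1)) (hMt : M ≤ padicValNat p W.tamagawaProduct) :
    IndexLowerBoundAt W p K P := by
  -- the fact: `2 (M₀ - M) ≤ ord_p #Ш(E/K)[p^∞]`
  have hle : 2 * (M₀ - M) ≤
      padicValNat p (Nat.card (AddCommGroup.primaryComponent (W.baseChange K).sha p)) :=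
    two_mul_sub_le_padicValNat_card_sha_primary_of_certificate hMc W hCM K hK h3 h4 hH p hp hsurj
      Dt β ι d₁ P hP hPinf hdiv hndiv d hn hℓ hcert
  -- B2 and B1
  have hsha : padicValNat p (W.baseChange K).shaOrder =
      padicValNat p (Nat.card (AddCommGroup.primaryComponent (W.baseChange K).sha p)) :=
    padicValNat_shaOrder_eq (W.baseChange K) p
  haveI : Finite (AddCommGroup.torsion (W.baseChange K).toAffine.Point) :=
    WeierstrassCurve.finite_torsion_point (W := W.baseChange K)
  obtain ⟨c, Q, hcQ, hcker⟩ :=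
    RankOne.exists_coord_of_mordellWeilRank_eq_one (W.baseChange K) hrank
  have hidx : padicValNat p (AddSubgroup.zmultiples P).index = M₀ :=
    padicValNat_index_zmultiples_eq_of_divisibility c Q hcQ hcker hiv P hdiv hndiv
  unfold IndexLowerBoundAt
  rw [hidx, hsha]
  omega

end Summit.BirchSwinnertonDyer.Rank1Residual.X11b.Three.Koly

end
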